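import Summits.KontsevichZagierPeriods.KontsevichZagierPeriods.Theorems.UnfoldedStokesStokesGenerationStubFibrewiseCalibrationBands
import Summits.KontsevichZagierPeriods.KontsevichZagierPeriods.Theorems.UnfoldedStokesStokesGenerationStubSpanToReps
import Literature.NumberTheory.Transcendental.SemialgebraicMapsProofs

/-!
# `StokesGeneration` (stmt-3586), line `fibrewise_stokes`, stub S3 — II: the last coordinate

Second helper file for the lead's stub `stub_fibrewiseStokesCalibration` (S3 of the line
`Cruxes/StokesGeneration/Lines/fibrewise_stokes.lean`): a fibrewise Stokes element along the LAST
coordinate of the closed cube `Q = [0,1]^{m+1}` is a relation of the four-move calculus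
(`of_mem_relations_fibStokes_last`, registered form `fibCal_last`).

Data: `G`, `D` `ℚ`-semialgebraic on `Q`, `|G| ≤ B`; a `ℚ`-semialgebraic `K` whose vertical fibres
through points of `Q` are finite; `G` continuous on each closed vertical fibre and differentiable
with derivative `D` at the interior points off `K`; `q = [Q, D − (G(·,1) − G(·,0))]`. Proof: split
`[Q, D]` and `[Q, G(·,1) − G(·,0)]` off `q` (rule (1b)); take a cylindrical decomposition of `ℝ^m`
adapted to the break set `K' = (K ∩ Q) ∪ ([0,1]^m × {0, 1})`
(`IsSemialgebraic.exists_cylindricalDecomposition.exists_fibre_eq`); since the vertical fibres of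
`K'` through the cube are finite, over every cell only GRAPHS of sections occur, among them the
faces `t = 0` and `t = 1`, which are the lowest and the highest adapted sections; cut both
representations along the cylinders (rule (1a)); cells whose trace on `[0,1]^m` is null carry null
pieces; over the other cells apply the band-by-band calibration of file I
(`of_sub_of_mem_relations_cellBands`) to the consecutive adapted sections, between which `G` is
differentiable along the fibre (a point strictly between consecutive adapted sections is off `K`).
[Kontsevich–Zagier 2001, §1.2, rules (1), (3); Basu–Pollack–Roy 2006, Cor. 5.7]
-/

noncomputable section

set_option linter.dupNamespace false

namespace Summit.KontsevichZagierPeriods.KontsevichZagierPeriods.Cruxes.StokesGeneration.FibrewiseStokes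

open MeasureTheory Set Filter Topology
open scoped ENNReal
open Literature.ModelTheory.ExponentialFields
  (IsSemialgebraic bandOver bandLower bandUpper graphOver mem_bandOver_iff snoc_mem_bandOver_iff)
open Literature.NumberTheory.Transcendental
open Literature.NumberTheory.Transcendental.KZ
open Summit.KontsevichZagierPeriods.KontsevichZagierPeriods.StokesGenerationLine (isSemialgebraic_cubePi)

variable {m : ℕ}

/-! ## Small facts -/

/-- The vertical fibre of any band of a stack of strictly increasing sections is an infinite set
of reals. [folklore] -/
theorem bandFibre_infinite {l : ℕ} (ξ : Fin l → (Fin m → ℝ) → ℝ) {x : Fin m → ℝ}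
    (hmono : StrictMono fun i => ξ i x) (j : Fin (l + 1)) :
    Set.Infinite {t : ℝ | bandLower ξ j x < (t : EReal) ∧ (t : EReal) < bandUpper ξ j x} := by
  by_cases h : j ≠ 0 ∧ j ≠ Fin.last l
  · rw [bandFibre_eq_Ioo ξ h.1 h.2]
    exact Set.Ioo_infinite (toReal_bandLower_lt_toReal_bandUpper ξ hmono h.1 h.2)
  · have hj : j = 0 ∨ j = Fin.last l := by tauto
    intro hfin
    have htop := volume_bandFibre_eq_top ξ hj x
    rw [hfin.measure_zero volume] at htop
    exact ENNReal.zero_ne_top htop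

/-- The cylinder over a cell, cut by the closed cube, is the band `0 ≤ t ≤ 1` over the trace of
the cell on `[0,1]^m`. [folklore] -/
theorem cubePi_inter_cyl_eq_band (C : Set (Fin m → ℝ)) :
    Set.pi Set.univ (fun _ : Fin (m + 1) => Set.Icc (0:ℝ) 1) ∩ {z | Fin.init z ∈ C} =
      KZlog.band (Set.pi Set.univ (fun _ : Fin m => Set.Icc (0:ℝ) 1) ∩ C) (fun _ => 0) (fun _ => 1) := by
  rw [cubePi_succ_eq_band]
  ext z
  simp only [mem_inter_iff, KZlog.mem_band, mem_setOf_eq]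
  tauto

/-- `x ↦ G(x, c)` lifted to the cylinder: `z ↦ G (init z, c)` is `ℚ`-semialgebraic on the closed
cube for a rational level `c ∈ [0,1]`. [cite: BochnakCosteRoy1998, Prop. 2.2.6] -/
theorem isSemialgebraicFunOn_face {G : (Fin (m + 1) → ℝ) → ℝ}
    (hG : IsSemialgebraicFunOn ℚ (Set.pi Set.univ (fun _ : Fin (m + 1) => Set.Icc (0:ℝ) 1)) G)
    (c : ℚ) (hc : ((c : ℝ)) ∈ Set.Icc (0:ℝ) 1) :
    IsSemialgebraicFunOn ℚ (Set.pi Set.univ (fun _ : Fin (m + 1) => Set.Icc (0:ℝ) 1))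
      (fun z => G (Fin.snoc (Fin.init z) (c : ℝ))) := by
  have hbase : IsSemialgebraicFunOn ℚ (Set.pi Set.univ (fun _ : Fin m => Set.Icc (0:ℝ) 1))
      (fun x => G (Fin.snoc x (c : ℝ))) :=
    isSemialgebraicFunOn_comp_snoc (isSemialgebraic_cubePi m) subset_rfl hG
      (isSemialgebraicFunOn_ratCast (isSemialgebraic_cubePi m) c) fun _ _ => hc
  refine hbase.comp_init.mono (fun z hz => ?_) (isSemialgebraic_cubePi (m + 1))
  rw [← Fin.snoc_init_self z, snoc_mem_cubePi_iff] at hz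
  exact hz.1

/-! ## The last-coordinate calibration -/

/-- **A fibrewise Stokes element along the last coordinate is a relation.** See the module
docstring. [cite: KontsevichZagier2001, §1.2 rules (1),(3)] -/
theorem of_mem_relations_fibStokes_last (G D : (Fin (m + 1) → ℝ) → ℝ) (K : Set (Fin (m + 1) → ℝ))
    (hG : IsSemialgebraicFunOn ℚ (Set.pi Set.univ (fun _ : Fin (m + 1) => Set.Icc (0:ℝ) 1)) G)
    (hD : IsSemialgebraicFunOn ℚ (Set.pi Set.univ (fun _ : Fin (m + 1) => Set.Icc (0:ℝ) 1)) D)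
    (hK : IsSemialgebraic ℚ K)
    (hB : ∃ B : ℝ, ∀ z ∈ Set.pi Set.univ (fun _ : Fin (m + 1) => Set.Icc (0:ℝ) 1), |G z| ≤ B)
    (hfin : ∀ z ∈ Set.pi Set.univ (fun _ : Fin (m + 1) => Set.Icc (0:ℝ) 1),
      Set.Finite {s : ℝ | Function.update z (Fin.last m) s ∈ K})
    (hcont : ∀ z ∈ Set.pi Set.univ (fun _ : Fin (m + 1) => Set.Icc (0:ℝ) 1),
      ContinuousOn (fun s : ℝ => G (Function.update z (Fin.last m) s)) (Set.Icc (0:ℝ) 1))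
    (hder : ∀ z ∈ Set.pi Set.univ (fun _ : Fin (m + 1) => Set.Icc (0:ℝ) 1), z ∉ K →
      z (Fin.last m) ∈ Set.Ioo (0:ℝ) 1 →
        HasDerivAt (fun s : ℝ => G (Function.update z (Fin.last m) s)) (D z) (z (Fin.last m)))
    (q : IntegralRep (m + 1)) (hqd : q.domain = Set.pi Set.univ (fun _ : Fin (m + 1) => Set.Icc (0:ℝ) 1))
    (hqi : ∀ z ∈ Set.pi Set.univ (fun _ : Fin (m + 1) => Set.Icc (0:ℝ) 1),
      q.integrand z = D z - (G (Function.update z (Fin.last m) 1) - G (Function.update z (Fin.last m) 0))) :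
    of q ∈ relations := by
  classical
  obtain ⟨B, hB⟩ := hB
  set Q : Set (Fin (m + 1) → ℝ) := Set.pi Set.univ (fun _ : Fin (m + 1) => Set.Icc (0:ℝ) 1) with hQ
  set Q₀ : Set (Fin m → ℝ) := Set.pi Set.univ (fun _ : Fin m => Set.Icc (0:ℝ) 1) with hQ₀
  have hQsa : IsSemialgebraic ℚ Q := isSemialgebraic_cubePi (m + 1)
  have hQ₀sa : IsSemialgebraic ℚ Q₀ := isSemialgebraic_cubePi m
  have hQm : MeasurableSet Q := IsSemialgebraic.measurableSet_holds hQsa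
  have hQfin : volume Q ≠ ⊤ := by
    rw [hQ, Summit.KontsevichZagierPeriods.KontsevichZagierPeriods.StokesGenerationLine.volume_unitCube]
    exact ENNReal.one_ne_top
  have hupd : ∀ (z : Fin (m + 1) → ℝ) (s : ℝ),
      Function.update z (Fin.last m) s = Fin.snoc (Fin.init z) s := fun z s => by
    conv_lhs => rw [← Fin.snoc_init_self z]
    exact Fin.update_snoc_last _ _ _
  -- the fibre datum `G(·,1) − G(·,0)` as a function on the cube
  set mf : (Fin (m + 1) → ℝ) → ℝ := fun z => G (Fin.snoc (Fin.init z) 1) - G (Fin.snoc (Fin.init z) 0)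
    with hmf
  have hmf_sa : IsSemialgebraicFunOn ℚ Q mf := by
    have h1 := isSemialgebraicFunOn_face hG 1 (by norm_num)
    have h0 := isSemialgebraicFunOn_face hG 0 (by norm_num)
    refine (IsSemialgebraicFunOn.sub_holds h1 h0).congr fun z _ => ?_
    simp only [Pi.sub_apply, Rat.cast_one, Rat.cast_zero, hmf]
  have hmf_bd : ∀ z ∈ Q, |mf z| ≤ B + B := fun z hz => by
    rw [hQ, ← Fin.snoc_init_self z, snoc_mem_cubePi_iff] at hz
    exact (abs_sub _ _).trans (add_le_add
      (hB _ ((snoc_mem_cubePi_iff _ _).2 ⟨hz.1, by norm_num⟩))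
      (hB _ ((snoc_mem_cubePi_iff _ _).2 ⟨hz.1, by norm_num⟩)))
  have hmf_int : IntegrableOn mf Q := integrableOn_of_abs_le hQsa hQfin hmf_sa hmf_bd
  -- `D` is integrable on the cube (`q` is, and `D = q + mf` there)
  have hDint : IntegrableOn D Q := by
    have hq_int : IntegrableOn q.integrand Q := hqd ▸ q.integrableOn
    refine (hq_int.add hmf_int).congr_fun (fun z hz => ?_) hQm
    simp only [Pi.add_apply, hqi z hz, hmf, hupd]
    ring
  -- the representations `[Q, D]` and `[Q, mf]`
  let RD : IntegralRep (m + 1) := ⟨Q, D, hQsa, hD, hDint⟩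
  let Rm : IntegralRep (m + 1) := ⟨Q, mf, hQsa, hmf_sa, hmf_int⟩
  have e0 : of RD - of q - of Rm ∈ relations :=
    integrandAddRel_subset_relations ⟨m + 1, RD, q, Rm, hqd, rfl, fun z hz => by
      show D z = q.integrand z + mf z
      rw [hqi z hz, hmf, hupd, hupd]; ring, rfl⟩
  -- it suffices to show `[Q, D] ≡ [Q, mf]`
  suffices hmain : of RD - of Rm ∈ relations by
    have : of q = (of RD - of Rm) - (of RD - of q - of Rm) := by abel
    rw [this]
    exact relations.sub_mem hmain e0
  -- cylindrical decomposition adapted to the break set `K' = (K ∩ Q) ∪ (Q₀ × {0,1})`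
  set K' : Set (Fin (m + 1) → ℝ) :=
    {z | Fin.init z ∈ Q₀ ∧ (z (Fin.last m) = 0 ∨ z (Fin.last m) = 1)} ∪ (K ∩ Q) with hK'
  have hK'sa : IsSemialgebraic ℚ K' := by
    refine IsSemialgebraic.union ?_ (hK.inter hQsa)
    have h0 : IsSemialgebraic ℚ {z : Fin (m + 1) → ℝ | z (Fin.last m) = 0} := by
      simpa using Literature.ModelTheory.ExponentialFields.isSemialgebraic_setOf_eval_eq_zero
        (k := ℚ) (R := ℝ) (MvPolynomial.X (Fin.last m) : MvPolynomial (Fin (m + 1)) ℚ)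
    have h1 : IsSemialgebraic ℚ {z : Fin (m + 1) → ℝ | z (Fin.last m) = 1} := by
      have h := Literature.ModelTheory.ExponentialFields.isSemialgebraic_setOf_eval_eq_zero
        (k := ℚ) (R := ℝ) (MvPolynomial.X (Fin.last m) - MvPolynomial.C 1 : MvPolynomial (Fin (m + 1)) ℚ)
      simp only [map_sub, MvPolynomial.aeval_X, map_one, sub_eq_zero] at h
      exact h
    convert hQ₀sa.setOf_init_mem.inter (h0.union h1) using 1
    ext z
    simp only [mem_setOf_eq, mem_inter_iff, mem_union]
  -- the vertical fibres of `K'` through points of the cube are finite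
  have hK'fib : ∀ x ∈ Q₀, Set.Finite {t : ℝ | (Fin.snoc x t : Fin (m + 1) → ℝ) ∈ K'} := by
    intro x hx
    have hz0 : (Fin.snoc x 0 : Fin (m + 1) → ℝ) ∈ Q := (snoc_mem_cubePi_iff x 0).2 ⟨hx, by norm_num⟩
    refine (((finite_singleton (0:ℝ)).union (finite_singleton (1:ℝ))).union (hfin _ hz0)).subset ?_
    intro t ht
    simp only [hK', mem_union, mem_setOf_eq, Fin.init_snoc, Fin.snoc_last, mem_inter_iff] at ht
    simp only [mem_union, mem_singleton_iff, mem_setOf_eq, Fin.update_snoc_last]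
    tauto
  obtain ⟨𝒮, l, ξ, hcd, -, hξ, hmono, -, hfib⟩ :=
    IsSemialgebraic.exists_cylindricalDecomposition.exists_fibre_eq
      (IsSemialgebraic.exists_cylindricalDecomposition_holds (k := ℚ)) hK'sa
  have hpart := hcd.isPartition
  have h𝒮sa := hcd.isSemialgebraic
  -- cut `[Q, D]` and `[Q, mf]` along the cylinders
  let RDc : {C // C ∈ 𝒮} → IntegralRep (m + 1) := fun C =>
    RD.restrict (RD.domain ∩ {z | Fin.init z ∈ (C : Set (Fin m → ℝ))})
      (hQsa.inter (h𝒮sa C C.2).setOf_init_mem) inter_subset_left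
  let Rmc : {C // C ∈ 𝒮} → IntegralRep (m + 1) := fun C =>
    Rm.restrict (Rm.domain ∩ {z | Fin.init z ∈ (C : Set (Fin m → ℝ))})
      (hQsa.inter (h𝒮sa C C.2).setOf_init_mem) inter_subset_left
  have eD : of RD - ∑ C ∈ 𝒮.attach, of (RDc C) ∈ relations :=
    of_sub_sum_cyl_mem_relations RD 𝒮 hpart RDc (fun C => rfl) fun C x _ => rfl
  have em : of Rm - ∑ C ∈ 𝒮.attach, of (Rmc C) ∈ relations :=
    of_sub_sum_cyl_mem_relations Rm 𝒮 hpart Rmc (fun C => rfl) fun C x _ => rfl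
  -- the cell-by-cell statement
  have hcell : ∀ C : {C // C ∈ 𝒮}, of (RDc C) - of (Rmc C) ∈ relations := by
    intro C
    set T : Set (Fin m → ℝ) := Q₀ ∩ (C : Set (Fin m → ℝ)) with hT
    have hTsa : IsSemialgebraic ℚ T := hQ₀sa.inter (h𝒮sa C C.2)
    have hTQ : T ⊆ Q₀ := inter_subset_left
    have hTC : T ⊆ (C : Set (Fin m → ℝ)) := inter_subset_right
    have hdomD : (RDc C).domain = KZlog.band T (fun _ => 0) (fun _ => 1) := cubePi_inter_cyl_eq_band _
    have hdomm : (Rmc C).domain = KZlog.band T (fun _ => 0) (fun _ => 1) := cubePi_inter_cyl_eq_band _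
    by_cases hT0 : volume T = 0
    · -- null trace: both pieces are null
      have hcyl := volume_setOf_init_mem_eq_zero (n := m) hT0
      have hsub : KZlog.band T (fun _ => (0:ℝ)) (fun _ => 1) ⊆ {z | Fin.init z ∈ T} := fun z hz => hz.1
      exact relations.sub_mem
        (of_mem_relations_of_volume_eq_zero _ (by rw [hdomD]; exact measure_mono_null hsub hcyl))
        (of_mem_relations_of_volume_eq_zero _ (by rw [hdomm]; exact measure_mono_null hsub hcyl))
    -- a cell with a trace of positive measure
    obtain ⟨x₀, hx₀⟩ := nonempty_of_measure_ne_zero hT0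
    obtain ⟨GC, BC, hGsub, hBsub, hfibC⟩ := hfib C C.2
    -- no bands over this cell (the fibres of `K'` through the cube are finite)
    have hBC : ∀ j ∈ BC, False := by
      intro j hj
      refine bandFibre_infinite (ξ C) (hmono C C.2 x₀ (hTC hx₀)) j ((hK'fib x₀ (hTQ hx₀)).subset ?_)
      intro t ht
      exact hBsub j hj (snoc_mem_bandOver_iff.2 ⟨hTC hx₀, ht.1, ht.2⟩)
    -- the fibre of `K'` over `x ∈ C` is the set of adapted section values
    have hfibre : ∀ x ∈ (C : Set (Fin m → ℝ)), ∀ t : ℝ,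
        (Fin.snoc x t : Fin (m + 1) → ℝ) ∈ K' ↔ ∃ j ∈ GC, t = ξ C j x := by
      intro x hx t
      have h := hfibC x hx
      have : t ∈ {t : ℝ | (Fin.snoc x t : Fin (m + 1) → ℝ) ∈ K'} ↔ t ∈ (⋃ j ∈ GC, {ξ C j x}) ∪
          ⋃ j ∈ BC, {t : ℝ | bandLower (ξ C) j x < t ∧ (t : EReal) < bandUpper (ξ C) j x} := by
        rw [h]
      simp only [mem_setOf_eq, mem_union, mem_iUnion, mem_singleton_iff, exists_prop] at this
      rw [this]
      constructor
      · rintro (h' | ⟨j, hj, -⟩)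
        · exact h'
        · exact (hBC j hj).elim
      · exact fun h' => Or.inl h'
    -- adapted section values over `T` lie in `[0,1]`, and `0`, `1` are among them
    have hval01 : ∀ x ∈ T, ∀ j ∈ GC, ξ C j x ∈ Set.Icc (0:ℝ) 1 := by
      intro x hx j hj
      have hmem : (Fin.snoc x (ξ C j x) : Fin (m + 1) → ℝ) ∈ K' := (hfibre x (hTC hx) _).2 ⟨j, hj, rfl⟩
      rcases hmem with ⟨-, h | h⟩ | ⟨-, hzQ⟩
      · rw [Fin.snoc_last] at h; rw [h]; norm_num
      · rw [Fin.snoc_last] at h; rw [h]; norm_num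
      · exact ((snoc_mem_cubePi_iff x _).1 hzQ).2
    have hzero : ∀ x ∈ T, ∃ j ∈ GC, (0:ℝ) = ξ C j x := fun x hx =>
      (hfibre x (hTC hx) 0).1 (Or.inl ⟨by simpa only [Fin.init_snoc] using hTQ hx,
        Or.inl (by simp only [Fin.snoc_last])⟩)
    have hone : ∀ x ∈ T, ∃ j ∈ GC, (1:ℝ) = ξ C j x := fun x hx =>
      (hfibre x (hTC hx) 1).1 (Or.inl ⟨by simpa only [Fin.init_snoc] using hTQ hx,
        Or.inr (by simp only [Fin.snoc_last])⟩)
    -- `GC` has at least two elements; enumerate it increasingly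
    obtain ⟨j0, hj0, hj0v⟩ := hzero x₀ hx₀
    obtain ⟨j1, hj1, hj1v⟩ := hone x₀ hx₀
    have hj01 : j0 ≠ j1 := fun h => by
      have : (0:ℝ) = 1 := by rw [hj0v, hj1v, h]
      norm_num at this
    have hcard : 2 ≤ GC.card := by
      rw [← Finset.card_pair hj01]
      exact Finset.card_le_card (Finset.insert_subset_iff.2 ⟨hj0, Finset.singleton_subset_iff.2 hj1⟩)
    obtain ⟨p, hp⟩ := Nat.exists_eq_add_of_le' hcard
    set e := GC.orderEmbOfFin hp with he
    have he_mem : ∀ k, e k ∈ GC := fun k => Finset.orderEmbOfFin_mem GC hp k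
    have he_surj : ∀ j ∈ GC, ∃ k, e k = j := fun j hj => by
      have : j ∈ Set.range e := by rw [he, Finset.range_orderEmbOfFin]; exact hj
      exact this
    set η : Fin (p + 2) → (Fin m → ℝ) → ℝ := fun k => ξ C (e k) with hη
    have hηsa : ∀ k, IsSemialgebraicFunOn ℚ T (η k) := fun k => (hξ C C.2 (e k)).mono hTC hTsa
    have hηmono : ∀ x ∈ T, StrictMono fun k => η k x := fun x hx =>
      (hmono C C.2 x (hTC hx)).comp e.strictMono
    have hη01 : ∀ x ∈ T, ∀ k, η k x ∈ Set.Icc (0:ℝ) 1 := fun x hx k => hval01 x hx _ (he_mem k)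
    have hη0 : ∀ x ∈ T, η 0 x = 0 := by
      intro x hx
      obtain ⟨j, hj, hjv⟩ := hzero x hx
      obtain ⟨k, rfl⟩ := he_surj j hj
      refine le_antisymm ?_ (hη01 x hx 0).1
      calc η 0 x ≤ η k x := (hηmono x hx).monotone (Fin.zero_le _)
        _ = 0 := hjv.symm
    have hη1 : ∀ x ∈ T, η (Fin.last (p + 1)) x = 1 := by
      intro x hx
      obtain ⟨j, hj, hjv⟩ := hone x hx
      obtain ⟨k, rfl⟩ := he_surj j hj
      refine le_antisymm (hη01 x hx _).2 ?_
      calc (1:ℝ) = η k x := hjv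
        _ ≤ η (Fin.last (p + 1)) x := (hηmono x hx).monotone (Fin.le_last _)
    -- fibrewise continuity and differentiability between consecutive adapted sections
    have hcont' : ∀ x ∈ T, ContinuousOn (fun s : ℝ => G (Fin.snoc x s)) (Set.Icc (0:ℝ) 1) := by
      intro x hx
      have h := hcont (Fin.snoc x 0) ((snoc_mem_cubePi_iff x 0).2 ⟨hTQ hx, by norm_num⟩)
      simpa only [Fin.update_snoc_last] using h
    have hder' : ∀ x ∈ T, ∀ k : Fin (p + 1), ∀ t ∈ Set.Ioo (η k.castSucc x) (η k.succ x),
        HasDerivAt (fun s : ℝ => G (Fin.snoc x s)) (D (Fin.snoc x t)) t := by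
      intro x hx k t ht
      have ht01 : t ∈ Set.Ioo (0:ℝ) 1 := by
        refine ⟨lt_of_le_of_lt ?_ ht.1, lt_of_lt_of_le ht.2 ?_⟩
        · rw [← hη0 x hx]; exact (hηmono x hx).monotone (Fin.zero_le _)
        · rw [← hη1 x hx]; exact (hηmono x hx).monotone (Fin.le_last _)
      have hzQ : (Fin.snoc x t : Fin (m + 1) → ℝ) ∈ Q :=
        (snoc_mem_cubePi_iff x t).2 ⟨hTQ hx, Ioo_subset_Icc_self ht01⟩
      have hzK : (Fin.snoc x t : Fin (m + 1) → ℝ) ∉ K := by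
        intro hzK
        obtain ⟨j, hj, hjv⟩ := (hfibre x (hTC hx) t).1 (Or.inr ⟨hzK, hzQ⟩)
        obtain ⟨k', rfl⟩ := he_surj j hj
        have h1' : η k.castSucc x < η k' x := by
          show η k.castSucc x < ξ C (e k') x
          rw [← hjv]; exact ht.1
        have h2' : η k' x < η k.succ x := by
          show ξ C (e k') x < η k.succ x
          rw [← hjv]; exact ht.2
        have h1 : k.castSucc < k' := (hηmono x hx).lt_iff_lt.1 h1'
        have h2 : k' < k.succ := (hηmono x hx).lt_iff_lt.1 h2'
        rw [Fin.lt_def, Fin.val_castSucc] at h1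
        rw [Fin.lt_def, Fin.val_succ] at h2
        omega
      have h := hder (Fin.snoc x t) hzQ hzK (by simpa only [Fin.snoc_last] using ht01)
      simpa only [Fin.update_snoc_last, Fin.snoc_last] using h
    -- the band-by-band calibration over this cell
    exact of_sub_of_mem_relations_cellBands hTsa hTQ η hηsa hηmono hη0 hη1 hG hD hDint hB hcont' hder'
      (RDc C) (Rmc C) hdomD (fun z _ => rfl) hdomm (fun z _ => rfl)
  -- assemble
  have esum : ∑ C ∈ 𝒮.attach, of (RDc C) - ∑ C ∈ 𝒮.attach, of (Rmc C) ∈ relations :=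
    sum_sub_sum_mem_relations _ _ _ fun C _ => hcell C
  have e : of RD - of Rm = (of RD - ∑ C ∈ 𝒮.attach, of (RDc C)) -
      (of Rm - ∑ C ∈ 𝒮.attach, of (Rmc C)) +
      (∑ C ∈ 𝒮.attach, of (RDc C) - ∑ C ∈ 𝒮.attach, of (Rmc C)) := by abel
  rw [e]
  exact relations.add_mem (relations.sub_mem eD em) esum

/-- **Last-coordinate calibration, registered form** (bookkeeping stub `fibCal_last` of crux
stmt-KontsevichZagierPeriods-3586, line `fibrewise_stokes`): see `of_mem_relations_fibStokes_last`.
[cite: KontsevichZagier2001, §1.2 rules (1),(3)] -/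
theorem fibCal_last : ∀ (m : ℕ) (G D : (Fin (m + 1) → ℝ) → ℝ) (K : Set (Fin (m + 1) → ℝ)) (q : IntegralRep (m + 1)), IsSemialgebraicFunOn ℚ (Set.pi Set.univ (fun _ : Fin (m + 1) => Set.Icc (0:ℝ) 1)) G → IsSemialgebraicFunOn ℚ (Set.pi Set.univ (fun _ : Fin (m + 1) => Set.Icc (0:ℝ) 1)) D → IsSemialgebraic ℚ K → (∃ B : ℝ, ∀ z ∈ Set.pi Set.univ (fun _ : Fin (m + 1) => Set.Icc (0:ℝ) 1), |G z| ≤ B) → (∀ z ∈ Set.pi Set.univ (fun _ : Fin (m + 1) => Set.Icc (0:ℝ) 1), Set.Finite {s : ℝ | Function.update z (Fin.last m) s ∈ K}) → (∀ z ∈ Set.pi Set.univ (fun _ : Fin (m + 1) => Set.Icc (0:ℝ) 1), ContinuousOn (fun s : ℝ => G (Function.update z (Fin.last m) s)) (Set.Icc (0:ℝ) 1)) → (∀ z ∈ Set.pi Set.univ (fun _ : Fin (m + 1) => Set.Icc (0:ℝ) 1), z ∉ K → z (Fin.last m) ∈ Set.Ioo (0:ℝ) 1 → HasDerivAt (fun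 s : ℝ => G (Function.update z (Fin.last m) s)) (D z) (z (Fin.last m))) → q.domain = Set.pi Set.univ (fun _ : Fin (m + 1) => Set.Icc (0:ℝ) 1) → (∀ z ∈ Set.pi Set.univ (fun _ : Fin (m + 1) => Set.Icc (0:ℝ) 1), q.integrand z = D z - (G (Function.update z (Fin.last m) 1) - G (Function.update z (Fin.last m) 0))) → of q ∈ relations :=
  fun _ G D K q hG hD hK hB hfin hcont hder hqd hqi =>
    of_mem_relations_fibStokes_last G D K hG hD hK hB hfin hcont hder q hqd hqi

end Summit.KontsevichZagierPeriods.KontsevichZagierPeriods.Cruxes.StokesGeneration.FibrewiseStokes
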